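import Summits.QuantumFields.YangMills.Theorems.BalabanUVNodesN15DefectKernelUnit
import Summits.QuantumFields.YangMills.Theorems.BalabanUVNodesN15OperatorReadout

/-!
# Route «BalabanUVNodes» (K4 «SpineRates»), node N15 = NE2 — THE KING-MODEL RUNG, part 1∕2: THE KING CARRIERS — the paired-instance family of
# King's ACTUAL A = 0 scalar unit-lattice covariances `C^{(k)} = (Δ^{(k)} + aL⁻²Q*Q)⁻¹` on every torus, the η-defect `𝔇(C^{(k+n)}, C^{(k)})`, the
# `U ≡ 1` unit-lattice derivatives and the four (3.42) entry operators (part 2∕2 `BalabanUVNodesN15KingModelNE2` reads the node's face `N15At` on them)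

Cell `pub-ymgap`, Track A (D-0062), seat `pub-ymgap-dag-n15-d` (R134 seat, strategy s3; director-ym R134 row «assemble `T4EtaRate.NE2PlusOperator` :250 ∕
`NE2PlusUnit` :265 … with King 1986 Lemma 4.5 (4.38) as the scalar kernel»; dag-lead FAN-OUT v1.1 §N15 s3 «KING-MODEL RUNG … `NE2_in_KingModel`»).
`bears_on: R4∕N15`; `--supports stmt-QuantumFields-19676` (K3).  COUNT-NEUTRAL; definition lane (the carriers are data; every theorem is plumbing).

THE PRINT (template literature, PUBLISHED AND PROVED).  [King1986] = C. King, CMP **102** (1986) 649–677, Lemma 4.5 (4.38) p. 674 *«|C^{(k)}(x, y) −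
C^{(k+n)}(x, y)| ≤ CL^{−k}e^{−δ₀|x−y|}»*, `C^{(k)} = (Δ^{(k)} + aL⁻²Q*Q)⁻¹` ((4.32) at `s = 1, 0`), *«in a finite volume Ω with periodic boundary
conditions»*; in the tree for King's ACTUAL operators on EVERY torus `Π_μ ℤ∕(LM_μ)`, constants `K₄₅(a,L,d)`, `δ₄₅(a,L,d) > 0` explicit:
`King1986.Torus.king_lemma45_torus` (`L ≥ 2`, `k, n ≥ 1`, `a, m² > 0`).  The pairing convention p. 664 (*«When x′ ∈ T_{η′}, we denote by x that point in T_η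
for which x′ ∈ B^n(x)»*) is the IDENTITY for unit-lattice objects: both runs' `C^{(·)}` live on the same unit lattice.  [B9] =
[Balaban1985BackgroundPropagators] (3.42) p. 397 supplies the SHAPE of the four entries (`G`, `∇_UG`, `G∇_U*`, `Δ_UG`) only.

CONTENTS (0 sorry).  §1 `KingIndex d L` (King's torus: `M_μ ≥ 1` blocks of side `L` per direction in dimension `d + 1`; `k ≥ 1`; shift `n ≥ 1`;
direction `ν`; the [B9] size parameter as a FREE coordinate `Msz ≥ 1` — it has no referent in King's model and is carried free so that the by-name
guard `M₅ ≤ M` of the node's shapes is LIVE and not the reason they hold, ref-B READ-323∕335 A2), the one-scale carrier `kingGeo` (sites = the unit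
lattice `Tor (fine L M)`, King's periodic distance `tdistT`, `η = L^{−k}`, `L^kη = 1`, `M := Msz`), the [B9] geometries `kingGeoC`∕`kingGeoF` = n15-b's
`N15.OperatorReadout.opGeo` over it with the argument sort REALISED by unit-lattice functions (every site its own block), the η-pairing `kingPairing`
(shift `n`, identity on sites AND arguments, one-point backgrounds `pt9Bg`), `kingInstance`.  §2 `kingCov` (BY NAME: `King1986.Torus.effLaplacian`,
`blockProj`, `King1986.aK`), `kingDefect = T4EtaRateDefect.idef id id (C^{(k+n)}) (C^{(k)})` (the currency of n15-a's `N15.DefectKernel.hasMaj_idef_kingCovariance`)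
and its point-source entries, the unit-lattice derivatives `fwdDiff`∕`adjDiff`∕`lapOp` with `adjDiff_single` (`∇_ν*δ_z = δ_{z+e_ν} − δ_z`) and the
decay-shift lemmas `exp_shift_add_le`∕`_sub_le`∕`_source_le` («a unit step moves the torus distance by ≤ 1», `King1986.Torus.tdistT_add_unitVec_le`), the four entry operators
`kingOps = ![𝔇, ∇_ν𝔇, 𝔇∇_ν*, Δ𝔇]`, the kernel family `kingOp` (n15-b's `opFamily`), the site∕unit kernel `kingKer`, `kingDist`, the constant `kingB0`.

HONEST FRAMING ∕ LIMITS.  King's `A = 0` SCALAR MODEL (abelian Higgs₂,₃ template literature) — NOT Bałaban's covariant `C^{(k)}(Λ; U)`, `G(U)`, `H(U)`,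
and NOT the carriers of record of Bałaban's run (NODE 00); nothing of [B9] is asserted; no estimate is proved in THIS part (part 2 proves the layers);
periodic b.c.; `k ≥ 1` (King's `a_k` is undefined at `k = 0`); Hölder ∕ L² ∕ global sorts inert as everywhere in the NE2 lineage.  Count-neutral; NOT a
node discharge; one finite torus programme at fixed ε — NOT ℝ⁴ ∕ infinite volume ∕ OS ∕ mass gap ∕ Clay.  Locators only: [King1986] p. 664, (4.32) p. 674,
Lemma 4.5 (4.38) p. 674; [B9] (3.42) p. 397, Thm 3.14 pp. 426–427 (the typing template of `T4EtaRate`).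
-/

noncomputable section

open scoped BigOperators
open Finset

namespace Summit.QuantumFields.YangMills.BalabanUVNodes.N15.KingModel

open Literature.MathematicalPhysics.QuantumFieldTheory.Balaban1983to89
open Literature.MathematicalPhysics.QuantumFieldTheory.Balaban1983to89.B11SectG (BlockNorm HasMaj)
open Literature.MathematicalPhysics.QuantumFieldTheory.Balaban1983to89.T4EtaRate (PairedInstance EtaPairing)
open Literature.MathematicalPhysics.QuantumFieldTheory.Balaban1983to89.T4EtaRateDefect (idef)
open Literature.MathematicalPhysics.QuantumFieldTheory.Balaban1983to89.T4EtaRateDefectSite (pt9Bg)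
open Literature.MathematicalPhysics.QuantumFieldTheory.Balaban1983to89.B5Prop11Plancherel (Tor fine unitVec)
open Literature.MathematicalPhysics.QuantumFieldTheory.King1986 (aK)
open Literature.MathematicalPhysics.QuantumFieldTheory.King1986.Torus (effLaplacian blockProj tdistT tdistT_triangle tdistT_symm
  tdistT_add_unitVec_le tdistT_sub_unitVec_le K45 delta45 K45_nonneg)
open Summit.QuantumFields.YangMills.BalabanUVNodes.N15.OperatorReadout (opGeo opFamily)
open Summit.QuantumFields.YangMills.BalabanUVNodes.N15.DefectKernel (idef_id_id_mulVecLin_single_apply)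

variable {d : ℕ}

/-! ## §1 The King family of paired instances -/

/-- THE INDEX of the King family at block factor `L` in torus dimension `d + 1`: King's torus `Ω` (`M_μ ≥ 1` blocks of side `L` per direction; unit
lattice `Π_μ ℤ∕(LM_μ)`), the coarse run's number of scales `k ≥ 1` (`η = L^{−k}`; Lemma 4.5 is printed for `k ≥ 1`), the scale shift `n ≥ 1`
(`η′ = L^{−n}η`), the direction `ν` of the derivative entries, and the [B9] size parameter as a FREE coordinate `Msz ≥ 1` (no referent in King's
model). [cite: King1986, Lemma 4.5 (4.38) p.674 (the quantifiers k, n ≥ 1 and the torus Ω)] -/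
structure KingIndex (d L : ℕ) where
  /-- the numbers of `L`-blocks per direction of King's torus (positive naturals) -/
  M : Fin (d + 1) → ℕ+
  /-- number of scales of the coarse run -/
  k : ℕ
  /-- `k ≥ 1` -/
  one_le_k : 1 ≤ k
  /-- scale shift to the fine run -/
  n : ℕ
  /-- `n ≥ 1` -/
  one_le_n : 1 ≤ n
  /-- direction of the derivative entries -/
  ν : Fin (d + 1)
  /-- the [B9] size parameter, free -/
  Msz : ℝ
  /-- `Msz ≥ 1` -/
  one_le_Msz : 1 ≤ Msz

/-- The block numbers as natural numbers (every one `NeZero` through the `ℕ+` coercion). [folklore] -/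
abbrev KingIndex.Mn {d L : ℕ} (i : KingIndex d L) : Fin (d + 1) → ℕ := fun μ => (i.M μ : ℕ)

/-- The index type is inhabited at every number of scales `k ≥ 1` (e.g. `M ≡ 1`, `n = 1`, `ν = 0`, `Msz = 1`). [folklore] -/
theorem kingIndex_nonempty (d L : ℕ) {k : ℕ} (hk : 1 ≤ k) : Nonempty (KingIndex d L) :=
  ⟨{ M := fun _ => 1, k := k, one_le_k := hk, n := 1, one_le_n := le_rfl, ν := 0, Msz := 1, one_le_Msz := le_rfl }⟩

/-- THE ONE-SCALE KING CARRIER at level `lvl` on the unit lattice `Π_μ ℤ∕K_μ`: every site at scale `lvl`, King's periodic distance `tdistT`,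
`η = L^{−lvl}`, block factor `L`, size parameter `Msz`; localisation ∕ cut-off sorts inert (the [B6] one-scale carrier of `B6UnitTorusCarrier`
with `M` free). [cite: King1986, Lemma 4.5 (4.38) p.674 (the carrier: unit lattice of a torus, torus distance)] -/
@[reducible] def kingGeo (L lvl : ℕ) (K : Fin (d + 1) → ℕ) [∀ μ, NeZero (K μ)] (Msz : ℝ) : B6.Geometry where
  Site := Tor K
  fin := inferInstance
  scale := fun _ => lvl
  dist := fun y y' => tdistT K y y'
  k := lvl
  eta := ((L : ℝ) ^ lvl)⁻¹
  L := L
  R := 1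
  M := Msz
  Hyp21_22 := True
  Loc := Unit
  suppIn := fun _ _ => True
  supNorm := fun _ => 0
  l2Norm := fun _ => 0
  holder := fun _ _ => 0
  Cut := Unit
  cutIn := fun _ _ => True
  cutH := fun _ _ => 0
  cutSup := fun _ => 0

/-- Every site of the King carrier has physical size `L^{lvl}η = 1` (`L ≠ 0`). [folklore] -/
theorem kingGeo_len {L : ℕ} (hL : L ≠ 0) (lvl : ℕ) (K : Fin (d + 1) → ℕ) [∀ μ, NeZero (K μ)] (Msz : ℝ) (y : Tor K) :
    (kingGeo L lvl K Msz).len y = 1 := by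
  show (L : ℝ) ^ lvl * ((L : ℝ) ^ lvl)⁻¹ = 1
  exact mul_inv_cancel₀ (pow_ne_zero _ (Nat.cast_ne_zero.mpr hL))

variable {L : ℕ} [NeZero L]

/-- King's unit lattice at an index: `Π_μ ℤ∕(LM_μ)` (`fine L M`). [cite: King1986, Lemma 4.5 (4.38) p.674 (the torus Ω)] -/
abbrev kingTor (i : KingIndex d L) : Fin (d + 1) → ℕ := fine L i.Mn

/-- THE COARSE [B9] GEOMETRY at an index: n15-b's realised operator geometry over the King carrier at level `k`, arguments = real functions on the
unit lattice, every site its own block. [cite: Balaban1985BackgroundPropagators, (3.42) p.397 (typing template)] -/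
@[reducible] def kingGeoC (i : KingIndex d L) : B9.Geometry :=
  opGeo (kingGeo L i.k (kingTor i) i.Msz) (Tor (kingTor i)) (fun x => x)

/-- THE FINE [B9] GEOMETRY at an index: the same at level `k + n` (the SAME unit lattice — King's `C^{(k)}` and `C^{(k+n)}` both live on it).
[cite: Balaban1985BackgroundPropagators, (3.42) p.397 (typing template)] -/
@[reducible] def kingGeoF (i : KingIndex d L) : B9.Geometry :=
  opGeo (kingGeo L (i.k + i.n) (kingTor i) i.Msz) (Tor (kingTor i)) (fun x => x)

/-- THE η-PAIRING of the two King geometries (`T4EtaRate.EtaPairing`, NOT PRINTED data in general — here King's own convention is available and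
is the IDENTITY: unit-lattice sites and unit-lattice test functions are the same in both runs): scale shift `n`, `ι = id`, `τ = id`, one-point
backgrounds. [cite: King1986, p.664 (convention before Prop. 3.8)] -/
def kingPairing (i : KingIndex d L) : EtaPairing (kingGeoC i) (kingGeoF i) pt9Bg pt9Bg where
  n := i.n
  k_eq := rfl
  L_eq := rfl
  M_eq := rfl
  eta_eq := by
    have hL0 : (L : ℝ) ≠ 0 := Nat.cast_ne_zero.mpr (NeZero.ne L)
    show (((L : ℝ) ^ (i.k + i.n)))⁻¹ * (L : ℝ) ^ i.n = (((L : ℝ) ^ i.k))⁻¹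
    rw [pow_add, mul_inv, mul_assoc, inv_mul_cancel₀ (pow_ne_zero _ hL0), mul_one]
  ι := fun y => y
  scale_ι := fun _ => rfl
  dist_ι := fun _ _ => rfl
  τ := fun lam => lam
  suppIn_τ := fun _ _ h => h
  supNorm_τ := fun _ => le_rfl
  avg := fun U => U
  avg_one := rfl

/-- THE KING FAMILY OF PAIRED INSTANCES (coarse∕fine realised geometries over the King carrier, one-point backgrounds, identity pairing).
[cite: Balaban1985BackgroundPropagators, Thm 3.14 pp.426–427 (typing template)] -/
def kingInstance (i : KingIndex d L) : PairedInstance :=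
  ⟨kingGeoC i, kingGeoF i, pt9Bg, pt9Bg, kingPairing i⟩

/-! ## §2 King's covariance, the η-defect and the four (3.42) entry operators -/

/-- KING'S UNIT-LATTICE COVARIANCE `C^{(lvl)} = (Δ^{(lvl)} + aL⁻²Q*Q)⁻¹` on `Π ℤ∕(LM_μ)` with `N = η⁻¹` fine points per unit block side (BY NAME:
`King1986.Torus.effLaplacian`, `blockProj`, `King1986.aK`) — the object of (4.32) at the endpoints. [cite: King1986, (4.32) p.674] -/
def kingCov (L : ℕ) [NeZero L] (M : Fin (d + 1) → ℕ) [∀ μ, NeZero (M μ)] (a m2 : ℝ) (N lvl : ℕ) [NeZero N] :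
    Matrix (Tor (fine L M)) (Tor (fine L M)) ℝ :=
  (effLaplacian N (fine L M) (aK a L lvl) (((N : ℕ) : ℝ) ^ 2) m2 + (a * ((L : ℝ) ^ 2)⁻¹) • blockProj L M)⁻¹

section Kernel

variable (a m2 : ℝ)

/-- THE η-DEFECT `𝔇(C^{(k+n)}, C^{(k)}) = C^{(k+n)} − C^{(k)}` of King's covariances under the identity pairing, as a linear operator on unit-lattice
functions (`T4EtaRateDefect.idef id id`). [cite: King1986, Lemma 4.5 (4.38) p.674 (the differenced object)] -/
def kingDefect (i : KingIndex d L) : (Tor (kingTor i) → ℝ) →ₗ[ℝ] (Tor (kingTor i) → ℝ) :=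
  idef LinearMap.id LinearMap.id
    (Matrix.mulVecLin (kingCov L i.Mn a m2 (L ^ i.n * L ^ i.k) (i.k + i.n)))
    (Matrix.mulVecLin (kingCov L i.Mn a m2 (L ^ i.k) i.k))

/-- The point-source entries of the defect are the differenced kernel: `𝔇(δ_z)(x) = C^{(k+n)}(x, z) − C^{(k)}(x, z)`. [folklore] -/
theorem kingDefect_single (i : KingIndex d L) (z x : Tor (kingTor i)) :
    kingDefect a m2 i (Pi.single z 1) x =
      kingCov L i.Mn a m2 (L ^ i.n * L ^ i.k) (i.k + i.n) x z - kingCov L i.Mn a m2 (L ^ i.k) i.k x z :=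
  idef_id_id_mulVecLin_single_apply _ _ z x

end Kernel

section Derivatives

variable (K : Fin (d + 1) → ℕ)

/-- The `U ≡ 1` forward difference on the unit lattice, `(∇_ν f)(x) = f(x + e_ν) − f(x)`. [cite: Balaban1985BackgroundPropagators, (3.42) p.397 (the entry ∇_U G at U ≡ 1: shape)] -/
def fwdDiff (ν : Fin (d + 1)) : (Tor K → ℝ) →ₗ[ℝ] (Tor K → ℝ) where
  toFun f := fun x => f (x + unitVec K ν) - f x
  map_add' f g := by ext x; simp only [Pi.add_apply]; ring
  map_smul' c f := by ext x; simp only [Pi.smul_apply, smul_eq_mul, RingHom.id_apply]; ring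

/-- The adjoint difference, `(∇_ν* f)(x) = f(x − e_ν) − f(x)`. [cite: Balaban1985BackgroundPropagators, (3.42) p.397 (the entry G∇*_U at U ≡ 1: shape)] -/
def adjDiff (ν : Fin (d + 1)) : (Tor K → ℝ) →ₗ[ℝ] (Tor K → ℝ) where
  toFun f := fun x => f (x - unitVec K ν) - f x
  map_add' f g := by ext x; simp only [Pi.add_apply]; ring
  map_smul' c f := by ext x; simp only [Pi.smul_apply, smul_eq_mul, RingHom.id_apply]; ring

/-- The unit-lattice Laplacian, `(Δf)(x) = Σ_μ (f(x + e_μ) + f(x − e_μ) − 2f(x))`. [cite: Balaban1985BackgroundPropagators, (3.42) p.397 (the entry Δ_U G at U ≡ 1: shape)] -/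
def lapOp : (Tor K → ℝ) →ₗ[ℝ] (Tor K → ℝ) where
  toFun f := fun x => ∑ μ : Fin (d + 1), (f (x + unitVec K μ) + f (x - unitVec K μ) - 2 * f x)
  map_add' f g := by
    ext x
    simp only [Pi.add_apply, ← Finset.sum_add_distrib]
    exact Finset.sum_congr rfl fun μ _ => by ring
  map_smul' c f := by
    ext x
    simp only [Pi.smul_apply, smul_eq_mul, RingHom.id_apply, Finset.mul_sum]
    exact Finset.sum_congr rfl fun μ _ => by ring

/-- Unfolding of `fwdDiff`. [folklore] -/
@[simp] theorem fwdDiff_apply (ν : Fin (d + 1)) (f : Tor K → ℝ) (x : Tor K) :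
    fwdDiff K ν f x = f (x + unitVec K ν) - f x := rfl

/-- Unfolding of `lapOp`. [folklore] -/
@[simp] theorem lapOp_apply (f : Tor K → ℝ) (x : Tor K) :
    lapOp K f x = ∑ μ : Fin (d + 1), (f (x + unitVec K μ) + f (x - unitVec K μ) - 2 * f x) := rfl

/-- The adjoint difference of a point source is a difference of point sources: `∇_ν* δ_z = δ_{z + e_ν} − δ_z`. [folklore] -/
theorem adjDiff_single (ν : Fin (d + 1)) (z : Tor K) :
    adjDiff K ν (Pi.single z 1) = Pi.single (z + unitVec K ν) 1 - Pi.single z 1 := by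
  ext w
  show Pi.single (M := fun _ => ℝ) z 1 (w - unitVec K ν) - Pi.single (M := fun _ => ℝ) z 1 w
    = Pi.single (M := fun _ => ℝ) (z + unitVec K ν) 1 w - Pi.single (M := fun _ => ℝ) z 1 w
  congr 1
  by_cases h : w = z + unitVec K ν
  · subst h
    simp
  · have h' : w - unitVec K ν ≠ z := fun h'' => h (by rw [← h'', sub_add_cancel])
    rw [Pi.single_eq_of_ne h', Pi.single_eq_of_ne h]

variable [∀ μ, NeZero (K μ)]

/-- A unit step of the observation point costs at most a factor `e^{δ}` in the decay (`δ ≥ 0`): `e^{−δ|x+e−z|_T} ≤ e^{δ}·e^{−δ|x−z|_T}`. [folklore] -/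
theorem exp_shift_add_le {δ : ℝ} (hδ : 0 ≤ δ) (x z : Tor K) (μ : Fin (d + 1)) :
    Real.exp (-(δ * tdistT K (x + unitVec K μ) z)) ≤ Real.exp δ * Real.exp (-(δ * tdistT K x z)) := by
  rw [← Real.exp_add]
  refine Real.exp_le_exp.mpr ?_
  have h1 : tdistT K x z ≤ tdistT K x (x + unitVec K μ) + tdistT K (x + unitVec K μ) z := tdistT_triangle K _ _ _
  have h2 : tdistT K x (x + unitVec K μ) ≤ 1 := tdistT_add_unitVec_le K x μ
  nlinarith

/-- The same for a backward unit step. [folklore] -/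
theorem exp_shift_sub_le {δ : ℝ} (hδ : 0 ≤ δ) (x z : Tor K) (μ : Fin (d + 1)) :
    Real.exp (-(δ * tdistT K (x - unitVec K μ) z)) ≤ Real.exp δ * Real.exp (-(δ * tdistT K x z)) := by
  rw [← Real.exp_add]
  refine Real.exp_le_exp.mpr ?_
  have h1 : tdistT K x z ≤ tdistT K x (x - unitVec K μ) + tdistT K (x - unitVec K μ) z := tdistT_triangle K _ _ _
  have h2 : tdistT K x (x - unitVec K μ) ≤ 1 := tdistT_sub_unitVec_le K x μ
  nlinarith

/-- The same for a unit step of the SOURCE point. [folklore] -/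
theorem exp_shift_source_le {δ : ℝ} (hδ : 0 ≤ δ) (x z : Tor K) (μ : Fin (d + 1)) :
    Real.exp (-(δ * tdistT K x (z + unitVec K μ))) ≤ Real.exp δ * Real.exp (-(δ * tdistT K x z)) := by
  rw [← Real.exp_add]
  refine Real.exp_le_exp.mpr ?_
  have h1 : tdistT K x z ≤ tdistT K x (z + unitVec K μ) + tdistT K (z + unitVec K μ) z := tdistT_triangle K _ _ _
  have h2 : tdistT K (z + unitVec K μ) z ≤ 1 := by
    rw [tdistT_symm]; exact tdistT_add_unitVec_le K z μ
  nlinarith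

end Derivatives

section Entries

variable (a m2 : ℝ)

/-- THE FOUR (3.42) ENTRY OPERATORS of the King family at an index: `![𝔇, ∇_ν𝔇, 𝔇∇_ν*, Δ𝔇]` with `𝔇 = 𝔇(C^{(k+n)}, C^{(k)})` and the `U ≡ 1`
unit-lattice derivatives (one configuration: the background carrier is the one-point `pt9Bg`). [cite: Balaban1985BackgroundPropagators, (3.42) p.397 (the four entries: shape)] -/
def kingOps (i : KingIndex d L) : Fin 4 → Unit → ((Tor (kingTor i) → ℝ) →ₗ[ℝ] (Tor (kingTor i) → ℝ)) :=
  fun m _ => ![kingDefect a m2 i, fwdDiff (kingTor i) i.ν ∘ₗ kingDefect a m2 i, kingDefect a m2 i ∘ₗ adjDiff (kingTor i) i.ν,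
    lapOp (kingTor i) ∘ₗ kingDefect a m2 i] m

/-- THE OPERATOR-LAYER KERNEL FAMILY of the King family: n15-b's `opFamily` of the four entry operators (entry `e m U λ y = |(T_m λ)(y)|`, every site its
own block). [cite: Balaban1985BackgroundPropagators, (3.42) p.397 (the four sup entries: shape)] -/
def kingOp (i : KingIndex d L) : B9.KernelFamily (kingInstance i).gc (kingInstance i).Bf :=
  show B9.KernelFamily (kingGeoC i) pt9Bg from
    opFamily (g := kingGeo L i.k (kingTor i) i.Msz) (fun x => x) (fun x => x) (kingOps a m2 i)

/-- THE SITE ∕ UNIT KERNEL of the King family: the differenced covariance kernel `C^{(k+n)}(y, y′) − C^{(k)}(y, y′)` itself (read on unit-lattice sites;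
King's `C^{(k)}` IS the unit-lattice covariance `C^{(k)}(Λ)` of the node's unit layer, with `Λ` = the whole torus at `A = 0`).
[cite: King1986, Lemma 4.5 (4.38) p.674; Balaban1985BackgroundPropagators, Thm 3.15 (3.187) p.432 (C^{(k)}(Λ): shape)] -/
def kingKer (i : KingIndex d L) : B9.SiteKernel (kingInstance i).gc (kingInstance i).Bf :=
  ⟨fun _ y y' => kingCov L i.Mn a m2 (L ^ i.n * L ^ i.k) (i.k + i.n) y y' - kingCov L i.Mn a m2 (L ^ i.k) i.k y y'⟩

/-- `unitDist :=` King's periodic unit-lattice distance `|y − y′|_T` (`tdistT`). [cite: King1986, Lemma 4.5 (4.38) p.674 (|x − y| on the torus)] -/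
def kingDist : ∀ i : KingIndex d L, (kingInstance i).gc.Site → (kingInstance i).gc.Site → ℝ :=
  fun i y y' => tdistT (kingTor i) y y'

/-- THE UNIFORM OPERATOR-LAYER CONSTANT `B₀^K(d, a, L) = 4(d+1)·e^{δ₄₅}·(K₄₅ + 1)` (the four entries cost at most `2(d+1)` shifted copies of (4.38),
each shift a factor `e^{δ₄₅}`). [folklore] -/
def kingB0 (d : ℕ) (a : ℝ) (L : ℕ) : ℝ := 4 * ((d : ℝ) + 1) * Real.exp (delta45 (d + 1) a L) * (K45 (d + 1) a L + 1)

/-- `B₀^K > 0`. [folklore] -/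
theorem kingB0_pos (d : ℕ) (a : ℝ) (L : ℕ) : 0 < kingB0 d a L := by
  unfold kingB0
  have := K45_nonneg (d := d + 1) a L
  positivity

end Entries

end Summit.QuantumFields.YangMills.BalabanUVNodes.N15.KingModel

end
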